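import Summits.MatrixMultiplication.MatrixMultiplication.Theses.CondensationDistance
import Summits.MatrixMultiplication.MatrixMultiplication.Theorems.CondensationDistanceShortCondensationStubTransportStepSchur
import Summits.MatrixMultiplication.MatrixMultiplication.Theorems.CondensationDistanceShortCondensationStubDodgsonExists

/-!
# Route `CondensationDistance` — the Schur-frame recursion, sorry-free

The sub-scheme recursion `D(n) ≤ T_schur(n, n/2) + D(n − n/2)` of the registered line
`Cruxes/ShortCondensation/Lines/schur.lean` on the crux `ShortCondensation` (stmt-MatrixMultiplication-15936),
with its two combinatorial stubs now DISCHARGED by the landed theorems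
`ShortCondensation.stub_transportStepSchur` (single-scale sub-scheme transport from the Schur sub-ball) and
`ShortCondensation.stub_dodgsonExists` (Dodgson floor, `D(n) ≤ n³` for `n ≥ 2`):

* `tightCondensation_of_schurFrame` — the engine statement `SchurFrame` (for every `ε > 0` and all large
  `n`, the leading `(n/2)`-minor and its bordered minors are derivable in `≤ n^(2+ε)` octahedral steps)
  implies the route's `TightCondensation`, unconditionally otherwise (strong induction with the bound
  `N³ + 2·n^(2+ε/2)`);
* `shortCondensation_of_schurFrame` — hence the crux `ShortCondensation` from `SchurFrame` alone (this is
  the line's composition with one hypothesis left: the engine, which is implied by the route item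
  `CheapHalfTransport`, `schurFrame_of_cheapHalfTransport`);
* `TransportToTight_proof : TransportToTight` — the support item stmt-MatrixMultiplication-15943
  (`CheapHalfTransport → TightCondensation`) BY NAME, sorry-free;
(The support item `TightToShort`, stmt-MatrixMultiplication-15942, is proved in `CondensationDistanceTightToShort.lean`.)
-/

set_option linter.dupNamespace false

namespace Summit.MatrixMultiplication.MatrixMultiplication.Theorems.ShortCondensation

open Summit.MatrixMultiplication.MatrixMultiplication.Theses.CondensationDistance

/-- **The Schur engine is implied by the route's `CheapHalfTransport`** (stmt-MatrixMultiplication-15938):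
the full radius-1 ball around `H = {n/2 ≤ x < n + n/2}` contains the Schur sub-ball, so knowing the former
knows the latter. [folklore] -/
theorem schurFrame_of_cheapHalfTransport (h : CheapHalfTransport) :
    ∀ ε : ℝ, 0 < ε → ∃ n₀ : ℕ, ∀ n ≥ n₀, ∃ (l : ℕ) (f : Fin l → Finset (Fin (n + n))), (l : ℝ) ≤ (n : ℝ) ^ (2 + ε) ∧ (∀ i : Fin l, ∃ p ∈ f i, ∃ q ∈ f i, p ≠ q ∧ ∃ u ∉ f i, ∃ v ∉ f i, u ≠ v ∧ ∀ J ∈ [insert u ((f i).erase p), insert v ((f i).erase p), insert u ((f i).erase q), insert v ((f i).erase q), insert u (insert v (((f i).erase p).erase q))], (J.card = n ∧ (J.filter fun x : Fin (n + n) => n ≤ x.val).card ≤ 1) ∨ ∃ j : Fin l, j < i ∧ f j = J) ∧ ∀ J : Finset (Fin (n + n)), J.card = n → (J \ (Finset.univ.filter fun x : Fin (n + n) => n / 2 ≤ x.val ∧ x.val < n + n / 2)).card ≤ 1 → (∀ x : Fin (n + n), n ≤ x.val → x.val < n + n / 2 → x ∈ J) → (∀ x ∈ J, n / 2 ≤ x.val)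 → (J.card = n ∧ (J.filter fun x : Fin (n + n) => n ≤ x.val).card ≤ 1) ∨ ∃ i : Fin l, f i = J := by
  intro ε hε
  obtain ⟨n₀, hn₀⟩ := h ε hε
  refine ⟨n₀, fun n hn => ?_⟩
  obtain ⟨l, f, hl, hv, hk⟩ := hn₀ n hn
  exact ⟨l, f, hl, hv, fun J hJ hd _ _ => hk J hJ hd⟩

/-- **The quantitative Schur-frame recursion, sorry-free.** If for every `ε > 0` and all large `n` the
Schur sub-ball of `H_{n/2}` is derivable in `≤ n^(2+ε)` steps (`SchurFrame`, the engine of line `schur`),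
then `TightCondensation` holds: `D(n) ≤ T(n) + D(n − n/2)` by the landed transport
`stub_transportStepSchur`, bottoming out on the landed Dodgson floor `stub_dodgsonExists` below the
engine's threshold; strong induction with the bound `N³ + 2·n^(2+ε/2)`, `n − n/2 ≤ 2n/3` for `n ≥ 3`,
`(2/3)^(2+ε/2) ≤ 4/9`, and `N³ + 2·n^(2+ε/2) ≤ n^(2+ε)` eventually. [folklore] -/
theorem tightCondensation_of_schurFrame
    (h₁ :
    ∀ ε : ℝ, 0 < ε → ∃ n₀ : ℕ, ∀ n ≥ n₀, ∃ (l : ℕ) (f : Fin l → Finset (Fin (n + n))), (l : ℝ) ≤ (n : ℝ) ^ (2 + ε) ∧ (∀ i : Fin l, ∃ p ∈ f i, ∃ q ∈ f i, p ≠ q ∧ ∃ u ∉ f i, ∃ v ∉ f i, u ≠ v ∧ ∀ J ∈ [insert u ((f i).erase p), insert v ((f i).erase p), insert u ((f i).erase q), insert v ((f i).erase q), insert u (insert v (((f i).erase p).erase q))], (J.card = n ∧ (J.filter fun x : Fin (n + n) => n ≤ x.val).card ≤ 1) ∨ ∃ j : Fin l, j < i ∧ f j = J) ∧ ∀ J :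 Finset (Fin (n + n)), J.card = n → (J \ (Finset.univ.filter fun x : Fin (n + n) => n / 2 ≤ x.val ∧ x.val < n + n / 2)).card ≤ 1 → (∀ x : Fin (n + n), n ≤ x.val → x.val < n + n / 2 → x ∈ J) → (∀ x ∈ J, n / 2 ≤ x.val) → (J.card = n ∧ (J.filter fun x : Fin (n + n) => n ≤ x.val).card ≤ 1) ∨ ∃ i : Fin l, f i = J) :
    TightCondensation := by
  have h₂ := @stub_transportStepSchur
  have h₃ := @stub_dodgsonExists
  intro ε hε
  have hε2 : 0 < ε / 2 := half_pos hε
  obtain ⟨n₀, hn₀⟩ := h₁ (ε / 2) hε2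
  -- the floor threshold `N ≥ n₀, 3`
  obtain ⟨N, hNn₀, hN3⟩ : ∃ N : ℕ, n₀ ≤ N ∧ 3 ≤ N := ⟨max n₀ 3, le_max_left _ _, le_max_right _ _⟩
  -- KEY RECURSION: every `n ≥ 2` has a valid derivation listing the target of length
  -- `≤ N³ + 2·n^(2+ε/2)` (floor below `N`, engine + transport + induction above).
  have key : ∀ n : ℕ, 2 ≤ n → ∃ (l : ℕ) (f : Fin l → Finset (Fin (n + n))),
      (∀ i : Fin l, ∃ p ∈ f i, ∃ q ∈ f i, p ≠ q ∧ ∃ u ∉ f i, ∃ v ∉ f i, u ≠ v ∧ ∀ J ∈ [insert u ((f i).erase p), insert v ((f i).erase p), insert u ((f i).erase q), insert v ((f i).erase q), insert u (insert v (((f i).erase p).erase q))], (J.card = n ∧ (J.filter fun x : Fin (n + n) => n ≤ x.val).card ≤ 1) ∨ ∃ j : Fin l, j < i ∧ f j = J) ∧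
      (∃ i : Fin l, f i = Finset.univ.filter fun x : Fin (n + n) => n ≤ x.val) ∧
      (l : ℝ) ≤ (N : ℝ) ^ (3 : ℕ) + 2 * (n : ℝ) ^ (2 + ε / 2) := by
    intro n
    induction n using Nat.strong_induction_on with
    | _ n ih =>
      intro h2n
      rcases Nat.lt_or_ge n N with hlt | hge
      · -- floor: an explicit (Dodgson) derivation of length ≤ n³ ≤ N³
        obtain ⟨l, f, hl, hv, ht⟩ := h₃ n h2n
        refine ⟨l, f, hv, ht, ?_⟩
        have hlN : (l : ℝ) ≤ (N : ℝ) ^ (3 : ℕ) := by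
          have h : l ≤ N ^ 3 := hl.trans (Nat.pow_le_pow_left hlt.le 3)
          exact_mod_cast h
        have h0 : (0 : ℝ) ≤ 2 * (n : ℝ) ^ (2 + ε / 2) := by positivity
        linarith
      · -- engine at scale `n`, transport, recursive call at `n' = n - n / 2 = ⌈n/2⌉`
        have hn₀n : n₀ ≤ n := hNn₀.trans hge
        have h3n : 3 ≤ n := hN3.trans hge
        obtain ⟨l₁, f₁, hl₁, hv₁, hk₁⟩ := hn₀ n hn₀n
        have hlt' : n - n / 2 < n := by omega
        have h2n' : 2 ≤ n - n / 2 := by omega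
        obtain ⟨l₂, f₂, hv₂, ht₂, hl₂⟩ := ih (n - n / 2) hlt' h2n'
        obtain ⟨l, f, hl, hv, ht⟩ :=
          h₂ n (n / 2) (n - n / 2) (by omega) l₁ f₁ l₂ f₂ hv₁ hk₁ hv₂ ht₂
        refine ⟨l, f, hv, ht, ?_⟩
        have hcast : (l : ℝ) ≤ (l₁ : ℝ) + (l₂ : ℝ) := by exact_mod_cast hl
        have hn' : ((n - n / 2 : ℕ) : ℝ) ≤ 2 / 3 * (n : ℝ) := by
          have h : 3 * (n - n / 2) ≤ 2 * n := by omega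
          have h' : (3 : ℝ) * ((n - n / 2 : ℕ) : ℝ) ≤ 2 * (n : ℝ) := by exact_mod_cast h
          linarith
        have hs : (0 : ℝ) ≤ 2 + ε / 2 := by linarith
        have h49 : (2 / 3 : ℝ) ^ (2 + ε / 2) ≤ 4 / 9 :=
          calc (2 / 3 : ℝ) ^ (2 + ε / 2) ≤ (2 / 3 : ℝ) ^ (2 : ℝ) :=
                Real.rpow_le_rpow_of_exponent_ge (by norm_num) (by norm_num) (by linarith)
            _ = 4 / 9 := by rw [Real.rpow_two]; norm_num
        have hpow : ((n - n / 2 : ℕ) : ℝ) ^ (2 + ε / 2) ≤ 4 / 9 * (n : ℝ) ^ (2 + ε / 2) :=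
          calc ((n - n / 2 : ℕ) : ℝ) ^ (2 + ε / 2)
              ≤ (2 / 3 * (n : ℝ)) ^ (2 + ε / 2) := Real.rpow_le_rpow (by positivity) hn' hs
            _ = (2 / 3 : ℝ) ^ (2 + ε / 2) * (n : ℝ) ^ (2 + ε / 2) :=
                Real.mul_rpow (by norm_num) (by positivity)
            _ ≤ 4 / 9 * (n : ℝ) ^ (2 + ε / 2) :=
                mul_le_mul_of_nonneg_right h49 (by positivity)
        have h0 : (0 : ℝ) ≤ (n : ℝ) ^ (2 + ε / 2) := by positivity
        linarith
  -- THRESHOLD: `N³ + 2·n^(2+ε/2) ≤ n^(2+ε)` as soon as `n^(ε/2) ≥ N³ + 2`.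
  have hev : ∀ᶠ n : ℕ in Filter.atTop, (N : ℝ) ^ (3 : ℕ) + 2 ≤ (n : ℝ) ^ (ε / 2) :=
    ((tendsto_rpow_atTop hε2).comp tendsto_natCast_atTop_atTop).eventually_ge_atTop _
  obtain ⟨n₁, hn₁⟩ := Filter.eventually_atTop.1 hev
  refine ⟨max n₁ 2, fun n hn => ?_⟩
  have hn1 : n₁ ≤ n := le_trans (le_max_left _ _) hn
  have hn2 : 2 ≤ n := le_trans (le_max_right _ _) hn
  obtain ⟨l, f, hv, ht, hl⟩ := key n hn2
  refine ⟨l, f, ?_, hv, ht⟩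
  have hnpos : (0 : ℝ) < n := by exact_mod_cast (show 0 < n by omega)
  have h1n : (1 : ℝ) ≤ n := by exact_mod_cast (show 1 ≤ n by omega)
  have hA : (1 : ℝ) ≤ (n : ℝ) ^ (2 + ε / 2) := Real.one_le_rpow h1n (by linarith)
  have hB : (N : ℝ) ^ (3 : ℕ) + 2 ≤ (n : ℝ) ^ (ε / 2) := hn₁ n hn1
  have hsplit : (n : ℝ) ^ (2 + ε) = (n : ℝ) ^ (2 + ε / 2) * (n : ℝ) ^ (ε / 2) := by
    rw [← Real.rpow_add hnpos]; congr 1; ring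
  rw [hsplit]
  have hN0 : (0 : ℝ) ≤ (N : ℝ) ^ (3 : ℕ) := by positivity
  have hstep1 : (n : ℝ) ^ (2 + ε / 2) * ((N : ℝ) ^ (3 : ℕ) + 2) ≤
      (n : ℝ) ^ (2 + ε / 2) * (n : ℝ) ^ (ε / 2) :=
    mul_le_mul_of_nonneg_left hB (by positivity)
  have hstep2 : (N : ℝ) ^ (3 : ℕ) ≤ (n : ℝ) ^ (2 + ε / 2) * (N : ℝ) ^ (3 : ℕ) :=
    le_mul_of_one_le_left hN0 hA
  linarith

/-- **The crux from the engine alone**: `SchurFrame → ShortCondensation` (take `m' = n ≤ n ^ 1`; the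
targets `{n ≤ x}` and `{n ≤ x < 2n}` coincide on `Fin (n + n)`).  This is the registered line `schur`
with its two combinatorial stubs discharged; the remaining hypothesis is its engine `stub_schurFrame`.
[folklore] -/
theorem shortCondensation_of_schurFrame
    (h₁ :
    ∀ ε : ℝ, 0 < ε → ∃ n₀ : ℕ, ∀ n ≥ n₀, ∃ (l : ℕ) (f : Fin l → Finset (Fin (n + n))), (l : ℝ) ≤ (n : ℝ) ^ (2 + ε) ∧ (∀ i : Fin l, ∃ p ∈ f i, ∃ q ∈ f i, p ≠ q ∧ ∃ u ∉ f i, ∃ v ∉ f i, u ≠ v ∧ ∀ J ∈ [insert u ((f i).erase p), insert v ((f i).erase p), insert u ((f i).erase q), insert v ((f i).erase q), insert u (insert v (((f i).erase p).erase q))], (J.card = n ∧ (J.filter fun x : Fin (n + n) => n ≤ x.val).card ≤ 1) ∨ ∃ j : Fin l, j < i ∧ f j = J) ∧ ∀ J : Finset (Fin (n + n)), J.card = n → (J \ (Finset.univ.filter fun x : Fin (n + n) => n / 2 ≤ x.val ∧ x.val < n + n / 2)).card ≤ 1 → (∀ x : Fin (n + n), n ≤ x.val → x.val < n + n / 2 →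 x ∈ J) → (∀ x ∈ J, n / 2 ≤ x.val) → (J.card = n ∧ (J.filter fun x : Fin (n + n) => n ≤ x.val).card ≤ 1) ∨ ∃ i : Fin l, f i = J) :
    ShortCondensation := by
  intro ε hε
  obtain ⟨n₀, hn₀⟩ := tightCondensation_of_schurFrame h₁ ε hε
  refine ⟨1, n₀, fun n hn => ⟨n, le_rfl, by simp, ?_⟩⟩
  obtain ⟨l, f, hl, hv, i, hi⟩ := hn₀ n hn
  refine ⟨l, f, hl, hv, i, ?_⟩
  rw [hi]
  refine Finset.filter_congr fun x _ => ⟨fun h => ⟨h, ?_⟩, fun h => h.1⟩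
  have hx := x.isLt
  omega

/-- **Support item `TransportToTight`** (stmt-MatrixMultiplication-15943,
`CheapHalfTransport → TightCondensation`), BY NAME and sorry-free: the route's frame-transport engine
implies the weaker Schur engine, and the Schur recursion does the rest. [folklore] -/
theorem TransportToTight_proof : TransportToTight :=
  fun h => tightCondensation_of_schurFrame (schurFrame_of_cheapHalfTransport h)

end Summit.MatrixMultiplication.MatrixMultiplication.Theorems.ShortCondensation
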